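import Summits.CriticalPhenomena.PercolationContinuityZ3.Theorems.PercAnnulusCrossingIICExistence
import Summits.CriticalPhenomena.PercolationContinuityZ3.Theorems.PercAnnulusCrossingSetToSetQuasiMultFixedAspect
import Summits.CriticalPhenomena.PercolationContinuityZ3.Theorems.PercAnnulusCrossingKestenIICSupercritical
import HarnessLib

/-!
# RSW3 lane: Kesten's IIC under (A2)□ — the named corollaries of p1's theorem (lead gen 4)

builds on p205010 (kernel theorem, internal audit signed; external expert review pending)

RSW3 lane (LANE 3 `prim-rsw3`), lead seat, gen 4.  Helper file (`--supports`); no definitions, no named facts, no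
sorries.  p1 gen 3's `kestenIICExistsAt_criticalProbI_of_setToSetQuasiMultAt` (p228659, file XX of the box-form
Kesten–Basu–Sapozhnikov scheme) proves: `2 ≤ d → 0 < ϰ → SetToSetQuasiMultAt d (criticalProbI d) ϰ → KestenIICExistsAt d (criticalProbI d)`.
This file reads it through the lane's typed vocabulary (defs v3–v5) and the lane's reductions:

* **`kestenIICExists_of_setToSetQuasiMult` — `SetToSetQuasiMult → KestenIICExists`**: (A2)□ at `p_c(ℤ³)` ⇒ Kesten's incipient
  infinite cluster on `ℤ³` exists — the LANE-4 target in its named form, KERNEL, no printed theorem (compare p219100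
  `kestenIIC_zd3_of_basuSapozhnikov`, which took Basu–Sapozhnikov's Thm. 1.1 as a named hypothesis);
* `kestenIICExistsAt_of_setToSetQuasiMultAspectAt_two_four` — the same from the aspect-`(2,4)` instance of defs v5
  (`setToSetQuasiMultAt_iff_aspect`); the general aspect `(s,L)` is NOT covered (the scheme runs at `(2,4)`);
* `kestenIICExistsAt_of_setToSetQM'_aspectTwo`, **`kestenIICExists_of_condAnnulusUniq_aspectTwo`** — the lane's reductions
  composed: the crossed-spheres form (A2′)₂ on `ℤ^d`, resp. CONDITIONAL ANNULUS-UNIQUENESS AT ASPECT 2 on `ℤ³` (p219928), imply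
  Kesten's IIC (census Q15: conditional uniqueness is numerically alive only at aspects `≥ 8–16`, so this chain is recorded,
  not advertised);
* **`kestenIICExistsAt_of_setToSetQuasiMultAt'` — for EVERY `0 < p` and `d ≥ 1`: `SetToSetQuasiMultAt d p ϰ → KestenIICExistsAt d p`**
  with no hypothesis on `θ`: either `θ(p) > 0` (then the IIC limit exists trivially, p220939 `kestenIICExistsAt_of_theta_pos`) or
  `θ(p) = 0` (p1's theorem).

Reading: with the census (Q17: ϰ̂ ≈ 0.2 flat incl. the thin-tube adversary; V56) the LANE-4 statement is 'IIC(ℤ³) holds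
conditionally on one typed, numerically plausible hypothesis, kernel-checked end to end'.  The printed graph-metric (A2)_ρ
reaches the box form only at aspect `(4d, 16d²)` (V67), hence needs the `(s,L)` version of the scheme — the one remaining
generalisation.

References: D. Basu, A. Sapozhnikov, ECP 22 (2017) no. 26, Thm. 1.1; H. Kesten, PTRF 73 (1986) Thm. (3).
-/

noncomputable section

namespace Summit.CriticalPhenomena.PercolationContinuityZ3.Theorems.Crossing

open MeasureTheory Literature.Probability.LatticeModels Literature.Probability.Percolation
open Summit.CriticalPhenomena.PercolationContinuityZ3.Theorems.SurfaceTension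

variable {d : ℕ}

/-- **(A2)□ at `p_c(ℤ³)` ⇒ Kesten's IIC on `ℤ³`**, in the lane's named Props: `SetToSetQuasiMult → KestenIICExists`.
[cite: BasuSapozhnikov2017ECP, Thm. 1.1] -/
theorem kestenIICExists_of_setToSetQuasiMult (h : SetToSetQuasiMult) : KestenIICExists := by
  obtain ⟨ϰ, hϰ, hA2⟩ := h
  exact kestenIICExistsAt_criticalProbI_of_setToSetQuasiMultAt (d := 3) (by norm_num) hϰ hA2

/-- The aspect-`(2,4)` instance of defs v5 suffices (it IS `SetToSetQuasiMultAt`). [cite: BasuSapozhnikov2017ECP, Thm. 1.1] -/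
theorem kestenIICExistsAt_of_setToSetQuasiMultAspectAt_two_four (hd : 2 ≤ d) {ϰ : ℝ} (hϰ : 0 < ϰ)
    (h : SetToSetQuasiMultAspectAt d (criticalProbI d) 2 4 ϰ) : KestenIICExistsAt d (criticalProbI d) :=
  kestenIICExistsAt_criticalProbI_of_setToSetQuasiMultAt hd hϰ (setToSetQuasiMultAt_iff_aspect.2 h)

/-- **The crossed-spheres form (A2′) at aspect 2 ⇒ Kesten's IIC at `p_c(ℤ^d)`** (`d ≥ 2`; via p219928
`setToSetQuasiMultAt_of_setToSetQM'_aspectTwo`). [cite: BasuSapozhnikov2017ECP, §3 eqs. (13)–(14) and Thm. 1.1] -/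
theorem kestenIICExistsAt_of_setToSetQM'_aspectTwo (hd : 2 ≤ d) {c : ℝ} (hc : 0 < c)
    (hA2' : ∀ a : ℕ, 1 ≤ a → ∀ Z : Finset (Site d), box d (2 * a) \ box d (a - 1) ⊆ Z →
      ∀ X : Finset (Site d), X ⊆ Z ∩ box d a → ∀ Y : Finset (Site d), Y ⊆ Z \ box d (2 * a) →
        c * (bondPercolation (zdGraph d) (criticalProbI d)).real
              {ω | ∃ x ∈ X, ∃ s ∈ innerBoundary (zdGraph d) (box d (2 * a)), ω ∈ openConnIn (↑Z : Set (Site d)) x s} *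
            (bondPercolation (zdGraph d) (criticalProbI d)).real
              {ω | ∃ y ∈ Y, ∃ s ∈ innerBoundary (zdGraph d) (box d a), ω ∈ openConnIn (↑Z : Set (Site d)) y s} ≤
          (bondPercolation (zdGraph d) (criticalProbI d)).real
            {ω | ∃ x ∈ X, ∃ y ∈ Y, ω ∈ openConnIn (↑Z : Set (Site d)) x y}) :
    KestenIICExistsAt d (criticalProbI d) :=
  kestenIICExistsAt_criticalProbI_of_setToSetQuasiMultAt hd (by positivity)
    (setToSetQuasiMultAt_of_setToSetQM'_aspectTwo hd hc.le hA2')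

/-- **Conditional annulus-uniqueness at aspect 2 at `p_c(ℤ³)` ⇒ Kesten's IIC on `ℤ³`** (p219928's reduction composed with
p1's theorem; kernel, no printed theorem). [cite: BasuSapozhnikov2017ECP, §1 (comments on (A2), p. 4) and Thm. 1.1] -/
theorem kestenIICExists_of_condAnnulusUniq_aspectTwo {c : ℝ} (hc : 0 < c)
    (hCU : ∀ a : ℕ, 1 ≤ a → ∀ Z : Finset (Site 3), box 3 (2 * a) \ box 3 (a - 1) ⊆ Z →
      ∀ X : Finset (Site 3), X ⊆ Z ∩ box 3 a → ∀ Y : Finset (Site 3), Y ⊆ Z \ box 3 (2 * a) →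
        c * (bondPercolation (zdGraph 3) (criticalProbI 3)).real
            ({ω | ∃ x ∈ X, ∃ s ∈ innerBoundary (zdGraph 3) (box 3 (2 * a)), ω ∈ openConnIn (↑Z : Set (Site 3)) x s} ∩
             {ω | ∃ y ∈ Y, ∃ s ∈ innerBoundary (zdGraph 3) (box 3 a), ω ∈ openConnIn (↑Z : Set (Site 3)) y s}) ≤
          (bondPercolation (zdGraph 3) (criticalProbI 3)).real
            ({ω | ∃ x ∈ X, ∃ s ∈ innerBoundary (zdGraph 3) (box 3 (2 * a)), ω ∈ openConnIn (↑Z : Set (Site 3)) x s} ∩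
             {ω | ∃ y ∈ Y, ∃ s ∈ innerBoundary (zdGraph 3) (box 3 a), ω ∈ openConnIn (↑Z : Set (Site 3)) y s} ∩
             {ω | ∀ t ∈ innerBoundary (zdGraph 3) (box 3 a), ∀ s ∈ innerBoundary (zdGraph 3) (box 3 (2 * a)),
                ∀ t' ∈ innerBoundary (zdGraph 3) (box 3 a), ∀ s' ∈ innerBoundary (zdGraph 3) (box 3 (2 * a)),
                ω ∈ openConnIn (↑((box 3 (2 * a) \ box 3 a) ∪ innerBoundary (zdGraph 3) (box 3 a)) : Set (Site 3)) t s →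
                ω ∈ openConnIn (↑((box 3 (2 * a) \ box 3 a) ∪ innerBoundary (zdGraph 3) (box 3 a)) : Set (Site 3)) t' s' →
                ω ∈ openConnIn (↑((box 3 (2 * a) \ box 3 a) ∪ innerBoundary (zdGraph 3) (box 3 a)) : Set (Site 3)) s s'})) :
    KestenIICExists :=
  kestenIICExists_of_setToSetQuasiMult (setToSetQuasiMult_of_condAnnulusUniq_aspectTwo hc hCU)

/-- **(A2)□ ⇒ Kesten's IIC at EVERY `p > 0`** (`d ≥ 1`), with no hypothesis on `θ`: if `θ(p) > 0` the IIC limit exists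
trivially (`kestenIICExistsAt_of_theta_pos`, p220939), and if `θ(p) = 0` by p1's theorem. [cite: BasuSapozhnikov2017ECP, Thm. 1.1] [cite: Kesten1986, Thm. (3)] -/
theorem kestenIICExistsAt_of_setToSetQuasiMultAt' (hd : 1 ≤ d) (p : unitInterval) (hp : 0 < (p : ℝ)) {ϰ : ℝ}
    (hϰ : 0 < ϰ) (hA2 : SetToSetQuasiMultAt d p ϰ) : KestenIICExistsAt d p := by
  by_cases hθ : theta (zdGraph d) (0 : Site d) p = 0
  · exact kestenIICExistsAt_of_setToSetQuasiMultAt hd p hp hθ hϰ hA2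
  · have h0 : 0 ≤ theta (zdGraph d) (0 : Site d) p := measureReal_nonneg
    exact kestenIICExistsAt_of_theta_pos (lt_of_le_of_ne h0 (Ne.symm hθ))

end Summit.CriticalPhenomena.PercolationContinuityZ3.Theorems.Crossing

end
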